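import Summits.KontsevichZagierPeriods.KontsevichZagierPeriods.Theorems.LinRedNormalFormWheelThreeSpokesCharts

/-!
# Line `laplacian-ldl-chart` — skeleton for crux `WheelThreeSpokes` (stmt-KontsevichZagierPeriods-3913)

Lead prover's reduction skeleton (crux protocol). `WheelThreeSpokes_of` concludes the crux
`LinRedNormalForm.WheelThreeSpokes` BY NAME from the stubs `stub_*` below; every stub is ONE or a
few instances of Kontsevich–Zagier's rules (1a) domain additivity, (1b) integrand additivity,
(2) change of variables, (3) Newton–Leibniz, between EXPLICIT positive rational absolutely
convergent representations. The chain (LDLᵀ chart of the reduced `K₄` Laplacian; crux-triage r1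
k=2, `Cruxes/WheelThreeSpokes/TRIAGE-r1-2.md` §1 F1–F2; all algebra re-verified exactly by the
lead, `work/numerics/chain_check.py`):

* `stub_dehomogenise` (rule 2, rational): `Ψ_typed(x) = det L̃(y)` with
  `(y₁₂,…,y₃₄) = (1, x₄, x₃, x₂, x₁, x₀)`; change of projective section `y₁₂ = 1 → y₁₂+y₁₃+y₁₄ = 1`:
  `[ℝ₊⁵, 1/Ψ²] ~ [Z5, 1/Ψᴰ(z)²]`, `z = (u, v, z₂, z₃, z₄)`, chart `x = (z₄, z₃, z₂, 1−u−v, v)/u`,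
  `|J| = 1/u⁶`, `Ψ(x) = Ψᴰ(z)/u³`.
* `stub_ldlChart` (rule 2, polynomial): the LDLᵀ chart `(u,v,w,d₂,d₃) ↦ (u, v, wd₂ − uv,
  d₂(1−w) − u(1−u−v), d₃ − C)`, `C = v(1−u−v) + w(1−w)d₂`, Jacobian `d₂`, `Ψᴰ = d₂d₃`:
  `[Z5, 1/Ψᴰ²] ~ [D5, 1/(d₂d₃²)]`.
* `stub_tailChart` (rule 2, rational): `d₃ = C/t`, `t ∈ (0,1)`: `[D5, 1/(d₂d₃²)] ~ [D5T, 1/(d₂C)]`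
  — the integrand no longer depends on the fibre variable `t`.
* `stub_nlFiveFour` (rule 3, `5 → 4`, primitive `t/(d₂C)`): `[D5T, 1/(d₂C)] ≡ F4 = [D4, 1/(d₂C)]`.
* `stub_doubling` (rules 1a + 2): the involution `(u,v,w,d₂) ↦ (u,1−u−v,1−w,d₂)` swaps the two
  regimes `P1`, `P2` of `D4` (wall `w(1−u) = v` null): `[F4] ≡ 2·[P2]`.
* `stub_moebius` (rule 2, rational): Möbius storage of the would-be logarithm,
  `s = βd₂/(α + βd₂)`, `α = v(1−u−v)`, `β = w(1−w)`: `[P2] ~ [Q, 1/(αs)]` in coordinates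
  `(u, v, s, w)` — the integrand no longer depends on the unipotent coordinate `w`.
* `stub_unipotentDescent` (rules 1a + 3 twice, `4 → 3`, primitives `w/(αs)`): split `Q` along the
  null wall `s(u+v) = u`, integrate `w` out over the fibres `(v/(1−u), sv/(u(1−s)))` resp.
  `(v/(1−u), 1)`: `[Q] ≡ [E] + [F]`.
* `stub_dihedralCharts` (rule 2, rational): `t = u/(u+v)` puts `E`, `F` on the simplex
  `1 > t₀ > t₁ > t₂ > 0` with dihedral integrands `E_dih`, `F_dih`.
* `stub_eSplit`, `stub_fSplit` (rule 1b): `E_dih = E₁ − E₂`, `F_dih = ζ(3)-word + ζ(2,1)-word`.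
* `stub_wordCharts` (rules 2 + 1a): `E₁ ≡ 2·ζ(2,1)-word`, `E₂ ≡ ζ(2,1)-word`.
* Charts file: duality `ζ(2,1) ~ ζ(3)` (one move) and `[Δ₃, 6/(…)] ≡ 6·[Δ₃, 1/(…)]`.

Total: `[r] ≡ 2·(E_dih + F_dih) ≡ 2·((2−1) + 2)·ζ(3) = 6·ζ(3) ≡ [r']`.
-/

noncomputable section

open Set MeasureTheory MvPolynomial
open Literature.NumberTheory.Transcendental
open Literature.ModelTheory.ExponentialFields (IsSemialgebraic isSemialgebraic_setOf_eval_lt)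
open Summit.KontsevichZagierPeriods.KontsevichZagierPeriods.Theses.LinRedNormalForm (WheelThreeSpokes)

namespace Summit.KontsevichZagierPeriods.LinRedNormalForm.WheelThreeSpokes.Skeleton

/-! ## Stubs -/

/-- **stub_dehomogenise** (M–L). Change of projective section (rule 2, rational chart
`x = (z₄, z₃, z₂, 1−z₀−z₁, z₁)/z₀` from `Z5` onto `ℝ₊⁵`, `|J| = 1/z₀⁶`,
`Ψ_typed(x) = Ψᴰ(z)/z₀³`; tools: `ratChart_transport`). -/
theorem stub_dehomogenise :
    (∀ r : KZ.IntegralRep 5, r.domain = {x | ∀ i, 0 < x i} →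
      Set.EqOn r.integrand (fun x => 1 / (x 0 * x 1 * x 3 + x 0 * x 1 * x 4 + x 0 * x 1 + x 0 * x 2 * x 3 + x 0 * x 2 * x 4 + x 0 * x 2 + x 0 * x 3 + x 0 * x 4 + x 1 * x 2 * x 3 + x 1 * x 2 * x 4 + x 1 * x 2 + x 1 * x 3 * x 4 + x 1 * x 4 + x 2 * x 3 * x 4 + x 2 * x 3 + x 3 * x 4) ^ 2) r.domain →
      ∃ s : KZ.IntegralRep 5, s.domain = {z : Fin 5 → ℝ | 0 < z 0 ∧ 0 < z 1 ∧ z 0 + z 1 < 1 ∧ 0 < z 2 ∧ 0 < z 3 ∧ 0 < z 4} ∧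
        s.integrand = fun z => 1 / ((z 0 + z 2 + z 3) * (z 1 + z 2 + z 4) - z 2 ^ 2 - z 0 ^ 2 * (z 1 + z 2 + z 4) - 2 * z 0 * z 1 * z 2 - z 1 ^ 2 * (z 0 + z 2 + z 3)) ^ 2) ∧
    (∀ s r : KZ.IntegralRep 5, s.domain = {z : Fin 5 → ℝ | 0 < z 0 ∧ 0 < z 1 ∧ z 0 + z 1 < 1 ∧ 0 < z 2 ∧ 0 < z 3 ∧ 0 < z 4} →
      Set.EqOn s.integrand (fun z => 1 / ((z 0 + z 2 + z 3) * (z 1 + z 2 + z 4) - z 2 ^ 2 - z 0 ^ 2 * (z 1 + z 2 + z 4) - 2 * z 0 * z 1 * z 2 - z 1 ^ 2 * (z 0 + z 2 + z 3)) ^ 2) s.domain →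
      r.domain = {x | ∀ i, 0 < x i} →
      Set.EqOn r.integrand (fun x => 1 / (x 0 * x 1 * x 3 + x 0 * x 1 * x 4 + x 0 * x 1 + x 0 * x 2 * x 3 + x 0 * x 2 * x 4 + x 0 * x 2 + x 0 * x 3 + x 0 * x 4 + x 1 * x 2 * x 3 + x 1 * x 2 * x 4 + x 1 * x 2 + x 1 * x 3 * x 4 + x 1 * x 4 + x 2 * x 3 * x 4 + x 2 * x 3 + x 3 * x 4) ^ 2) r.domain →
      KZ.Equivalent s r) := by
  sorry

/-- **stub_ldlChart** (M). The LDLᵀ chart of the reduced `K₄` Laplacian (rule 2, POLYNOMIAL chart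
`(u,v,w,d₂,d₃) ↦ (u, v, w d₂ − u v, d₂(1−w) − u(1−u−v), d₃ − v(1−u−v) − w(1−w)d₂)` from `D5` onto
`Z5`, Jacobian `d₂`, `Ψᴰ ∘ chart = d₂ d₃`; tools: `polyChart_transport`). -/
theorem stub_ldlChart :
    (∀ s : KZ.IntegralRep 5, s.domain = {z : Fin 5 → ℝ | 0 < z 0 ∧ 0 < z 1 ∧ z 0 + z 1 < 1 ∧ 0 < z 2 ∧ 0 < z 3 ∧ 0 < z 4} →
      Set.EqOn s.integrand (fun z => 1 / ((z 0 + z 2 + z 3) * (z 1 + z 2 + z 4) - z 2 ^ 2 - z 0 ^ 2 * (z 1 + z 2 + z 4) - 2 * z 0 * z 1 * z 2 - z 1 ^ 2 * (z 0 + z 2 + z 3)) ^ 2) s.domain →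
      ∃ d : KZ.IntegralRep 5, d.domain = {y : Fin 5 → ℝ | 0 < y 0 ∧ 0 < y 1 ∧ y 0 + y 1 < 1 ∧ y 0 * y 1 < y 2 * y 3 ∧ y 0 * (1 - y 0 - y 1) < y 3 * (1 - y 2) ∧ y 1 * (1 - y 0 - y 1) + y 2 * (1 - y 2) * y 3 < y 4} ∧
        d.integrand = fun y => 1 / (y 3 * y 4 ^ 2)) ∧
    (∀ d s : KZ.IntegralRep 5, d.domain = {y : Fin 5 → ℝ | 0 < y 0 ∧ 0 < y 1 ∧ y 0 + y 1 < 1 ∧ y 0 * y 1 < y 2 * y 3 ∧ y 0 * (1 - y 0 - y 1) < y 3 * (1 - y 2) ∧ y 1 * (1 - y 0 - y 1) + y 2 * (1 - y 2) * y 3 < y 4} →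
      Set.EqOn d.integrand (fun y => 1 / (y 3 * y 4 ^ 2)) d.domain →
      s.domain = {z : Fin 5 → ℝ | 0 < z 0 ∧ 0 < z 1 ∧ z 0 + z 1 < 1 ∧ 0 < z 2 ∧ 0 < z 3 ∧ 0 < z 4} →
      Set.EqOn s.integrand (fun z => 1 / ((z 0 + z 2 + z 3) * (z 1 + z 2 + z 4) - z 2 ^ 2 - z 0 ^ 2 * (z 1 + z 2 + z 4) - 2 * z 0 * z 1 * z 2 - z 1 ^ 2 * (z 0 + z 2 + z 3)) ^ 2) s.domain →
      KZ.Equivalent d s) := by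
  sorry

/-- **stub_tailChart** (S–M). Compactification of the `d₃`-tail (rule 2, rational chart
`(u,v,w,d₂,t) ↦ (u,v,w,d₂, C/t)`, `C = v(1−u−v) + w(1−w)d₂ > 0`, from `D5T` onto `D5`, `|J| = C/t²`;
the pulled-back integrand `1/(d₂C)` is `t`-free; tools: `ratChart_transport`, lower-triangular
Jacobian). -/
theorem stub_tailChart :
    (∀ d : KZ.IntegralRep 5, d.domain = {y : Fin 5 → ℝ | 0 < y 0 ∧ 0 < y 1 ∧ y 0 + y 1 < 1 ∧ y 0 * y 1 < y 2 * y 3 ∧ y 0 * (1 - y 0 - y 1) < y 3 * (1 - y 2) ∧ y 1 * (1 - y 0 - y 1) + y 2 * (1 - y 2) * y 3 < y 4} →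
      Set.EqOn d.integrand (fun y => 1 / (y 3 * y 4 ^ 2)) d.domain →
      ∃ b : KZ.IntegralRep 5, b.domain = {y : Fin 5 → ℝ | 0 < y 0 ∧ 0 < y 1 ∧ y 0 + y 1 < 1 ∧ y 0 * y 1 < y 2 * y 3 ∧ y 0 * (1 - y 0 - y 1) < y 3 * (1 - y 2) ∧ 0 < y 4 ∧ y 4 < 1} ∧
        b.integrand = fun y => 1 / (y 3 * (y 1 * (1 - y 0 - y 1) + y 2 * (1 - y 2) * y 3))) ∧
    (∀ b d : KZ.IntegralRep 5, b.domain = {y : Fin 5 → ℝ | 0 < y 0 ∧ 0 < y 1 ∧ y 0 + y 1 < 1 ∧ y 0 * y 1 < y 2 * y 3 ∧ y 0 * (1 - y 0 - y 1) < y 3 * (1 - y 2) ∧ 0 < y 4 ∧ y 4 < 1} →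
      Set.EqOn b.integrand (fun y => 1 / (y 3 * (y 1 * (1 - y 0 - y 1) + y 2 * (1 - y 2) * y 3))) b.domain →
      d.domain = {y : Fin 5 → ℝ | 0 < y 0 ∧ 0 < y 1 ∧ y 0 + y 1 < 1 ∧ y 0 * y 1 < y 2 * y 3 ∧ y 0 * (1 - y 0 - y 1) < y 3 * (1 - y 2) ∧ y 1 * (1 - y 0 - y 1) + y 2 * (1 - y 2) * y 3 < y 4} →
      Set.EqOn d.integrand (fun y => 1 / (y 3 * y 4 ^ 2)) d.domain →
      KZ.Equivalent b d) := by
  sorry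

/-- **stub_nlFiveFour** (S; lead). Newton–Leibniz `5 → 4` along the `t`-fibres `[0,1]` with the
rational primitive `t/(d₂C)` (reverse unfolding `exists_unfold_step` of the base `F4`, then
congruence of the two open-band representations). -/
theorem stub_nlFiveFour :
    ∀ (b : KZ.IntegralRep 5) (r₄ : KZ.IntegralRep 4),
      b.domain = {y : Fin 5 → ℝ | 0 < y 0 ∧ 0 < y 1 ∧ y 0 + y 1 < 1 ∧ y 0 * y 1 < y 2 * y 3 ∧ y 0 * (1 - y 0 - y 1) < y 3 * (1 - y 2) ∧ 0 < y 4 ∧ y 4 < 1} →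
      Set.EqOn b.integrand (fun y => 1 / (y 3 * (y 1 * (1 - y 0 - y 1) + y 2 * (1 - y 2) * y 3))) b.domain →
      r₄.domain = {p : Fin 4 → ℝ | 0 < p 0 ∧ 0 < p 1 ∧ p 0 + p 1 < 1 ∧ p 0 * p 1 < p 2 * p 3 ∧ p 0 * (1 - p 0 - p 1) < p 3 * (1 - p 2)} →
      Set.EqOn r₄.integrand (fun p => 1 / (p 3 * (p 1 * (1 - p 0 - p 1) + p 2 * (1 - p 2) * p 3))) r₄.domain →
      KZ.of b - KZ.of r₄ ∈ KZ.relations := by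
  sorry

/-- **stub_doubling** (M). `D4 = P1 ⊔ P2 ⊔ (null wall w(1−u) = v)` (rule 1a) and the affine
involution `ι(u,v,w,d₂) = (u, 1−u−v, 1−w, d₂)` (rule 2, `|det| = 1`, polynomial; preserves the
integrand, maps `P2` onto `P1 = {0<u, 0<v, u+v<1, w(1−u) < v, 0 < w, uv < w d₂}`); existence of
the `D4` representation from the `P2` one (transport + union). Tools: `polyChart_transport`,
`KZ.IntegralRep.of_sub_of_restrict_mem_relations`, `KZ.of_sub_of_mem_relations_of_eqOn`. -/
theorem stub_doubling :
    (∀ p : KZ.IntegralRep 4, p.domain = {p : Fin 4 → ℝ | 0 < p 0 ∧ 0 < p 1 ∧ p 0 + p 1 < 1 ∧ p 1 < p 2 * (1 - p 0) ∧ p 2 < 1 ∧ p 0 * (1 - p 0 - p 1) < p 3 * (1 - p 2)} →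
      Set.EqOn p.integrand (fun p => 1 / (p 3 * (p 1 * (1 - p 0 - p 1) + p 2 * (1 - p 2) * p 3))) p.domain →
      ∃ r₄ : KZ.IntegralRep 4, r₄.domain = {p : Fin 4 → ℝ | 0 < p 0 ∧ 0 < p 1 ∧ p 0 + p 1 < 1 ∧ p 0 * p 1 < p 2 * p 3 ∧ p 0 * (1 - p 0 - p 1) < p 3 * (1 - p 2)} ∧
        r₄.integrand = fun p => 1 / (p 3 * (p 1 * (1 - p 0 - p 1) + p 2 * (1 - p 2) * p 3))) ∧
    (∀ r₄ p : KZ.IntegralRep 4, r₄.domain = {p : Fin 4 → ℝ | 0 < p 0 ∧ 0 < p 1 ∧ p 0 + p 1 < 1 ∧ p 0 * p 1 < p 2 * p 3 ∧ p 0 * (1 - p 0 - p 1) < p 3 * (1 - p 2)} →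
      Set.EqOn r₄.integrand (fun p => 1 / (p 3 * (p 1 * (1 - p 0 - p 1) + p 2 * (1 - p 2) * p 3))) r₄.domain →
      p.domain = {p : Fin 4 → ℝ | 0 < p 0 ∧ 0 < p 1 ∧ p 0 + p 1 < 1 ∧ p 1 < p 2 * (1 - p 0) ∧ p 2 < 1 ∧ p 0 * (1 - p 0 - p 1) < p 3 * (1 - p 2)} →
      Set.EqOn p.integrand (fun p => 1 / (p 3 * (p 1 * (1 - p 0 - p 1) + p 2 * (1 - p 2) * p 3))) p.domain →
      KZ.of r₄ - 2 • KZ.of p ∈ KZ.relations) := by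
  sorry

/-- **stub_moebius** (M). Möbius storage (rule 2, rational chart `(u,v,w,d₂) ↦ (u, v, s, w)`,
`s = βd₂/(α+βd₂)`, `α = v(1−u−v)`, `β = w(1−w)`, from `P2` onto
`Q = {0<u, 0<v, u+v<1, v < w(1−u), w<1, wu < s(v+wu), s<1}` (coordinates `q = (u,v,s,w)`),
`|J| = αβ/(α+βd₂)²`, inverse `d₂ = αs/(β(1−s))`; pulled-back integrand `1/(αs)`).
Tools: `ratChart_transport`. -/
theorem stub_moebius :
    (∀ q : KZ.IntegralRep 4, q.domain = {q : Fin 4 → ℝ | 0 < q 0 ∧ 0 < q 1 ∧ q 0 + q 1 < 1 ∧ q 1 < q 3 * (1 - q 0) ∧ q 3 < 1 ∧ q 3 * q 0 < q 2 * (q 1 + q 3 * q 0) ∧ q 2 < 1} →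
      Set.EqOn q.integrand (fun q => 1 / (q 1 * (1 - q 0 - q 1) * q 2)) q.domain →
      ∃ p : KZ.IntegralRep 4, p.domain = {p : Fin 4 → ℝ | 0 < p 0 ∧ 0 < p 1 ∧ p 0 + p 1 < 1 ∧ p 1 < p 2 * (1 - p 0) ∧ p 2 < 1 ∧ p 0 * (1 - p 0 - p 1) < p 3 * (1 - p 2)} ∧
        p.integrand = fun p => 1 / (p 3 * (p 1 * (1 - p 0 - p 1) + p 2 * (1 - p 2) * p 3))) ∧
    (∀ p q : KZ.IntegralRep 4, p.domain = {p : Fin 4 → ℝ | 0 < p 0 ∧ 0 < p 1 ∧ p 0 + p 1 < 1 ∧ p 1 < p 2 * (1 - p 0) ∧ p 2 < 1 ∧ p 0 * (1 - p 0 - p 1) < p 3 * (1 - p 2)} →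
      Set.EqOn p.integrand (fun p => 1 / (p 3 * (p 1 * (1 - p 0 - p 1) + p 2 * (1 - p 2) * p 3))) p.domain →
      q.domain = {q : Fin 4 → ℝ | 0 < q 0 ∧ 0 < q 1 ∧ q 0 + q 1 < 1 ∧ q 1 < q 3 * (1 - q 0) ∧ q 3 < 1 ∧ q 3 * q 0 < q 2 * (q 1 + q 3 * q 0) ∧ q 2 < 1} →
      Set.EqOn q.integrand (fun q => 1 / (q 1 * (1 - q 0 - q 1) * q 2)) q.domain →
      KZ.of p - KZ.of q ∈ KZ.relations) := by
  sorry

/-- **stub_unipotentDescent** (L; lead). `Q = Q_E ⊔ Q_F ⊔ (null wall s(u+v) = u)` (rule 1a), and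
two Newton–Leibniz moves `4 → 3` along the unipotent coordinate `w` (last coordinate), of which the
integrand `1/(αs)` is free: fibres `(v/(1−u), sv/(u(1−s)))` over
`BE = {0<u, 0<v, u+v<1, u<s, s(u+v)<u}` and `(v/(1−u), 1)` over
`BF = {0<u, 0<v, u+v<1, u < s(u+v), s<1}` (reverse unfolding `exists_unfold_step_fun` with
semialgebraic fibre ends). -/
theorem stub_unipotentDescent :
    (∀ e f : KZ.IntegralRep 3, e.domain = {e : Fin 3 → ℝ | 0 < e 0 ∧ 0 < e 1 ∧ e 0 + e 1 < 1 ∧ e 0 < e 2 ∧ e 2 * (e 0 + e 1) < e 0} →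
      Set.EqOn e.integrand (fun e => (e 2 - e 0) / (e 0 * (1 - e 0) * (1 - e 2) * (1 - e 0 - e 1) * e 2)) e.domain →
      f.domain = {f : Fin 3 → ℝ | 0 < f 0 ∧ 0 < f 1 ∧ f 0 + f 1 < 1 ∧ f 0 < f 2 * (f 0 + f 1) ∧ f 2 < 1} →
      Set.EqOn f.integrand (fun f => 1 / ((1 - f 0) * f 1 * f 2)) f.domain →
      ∃ q : KZ.IntegralRep 4, q.domain = {q : Fin 4 → ℝ | 0 < q 0 ∧ 0 < q 1 ∧ q 0 + q 1 < 1 ∧ q 1 < q 3 * (1 - q 0) ∧ q 3 < 1 ∧ q 3 * q 0 < q 2 * (q 1 + q 3 * q 0) ∧ q 2 < 1} ∧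
        q.integrand = fun q => 1 / (q 1 * (1 - q 0 - q 1) * q 2)) ∧
    (∀ (q : KZ.IntegralRep 4) (e f : KZ.IntegralRep 3),
      q.domain = {q : Fin 4 → ℝ | 0 < q 0 ∧ 0 < q 1 ∧ q 0 + q 1 < 1 ∧ q 1 < q 3 * (1 - q 0) ∧ q 3 < 1 ∧ q 3 * q 0 < q 2 * (q 1 + q 3 * q 0) ∧ q 2 < 1} →
      Set.EqOn q.integrand (fun q => 1 / (q 1 * (1 - q 0 - q 1) * q 2)) q.domain →
      e.domain = {e : Fin 3 → ℝ | 0 < e 0 ∧ 0 < e 1 ∧ e 0 + e 1 < 1 ∧ e 0 < e 2 ∧ e 2 * (e 0 + e 1) < e 0} →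
      Set.EqOn e.integrand (fun e => (e 2 - e 0) / (e 0 * (1 - e 0) * (1 - e 2) * (1 - e 0 - e 1) * e 2)) e.domain →
      f.domain = {f : Fin 3 → ℝ | 0 < f 0 ∧ 0 < f 1 ∧ f 0 + f 1 < 1 ∧ f 0 < f 2 * (f 0 + f 1) ∧ f 2 < 1} →
      Set.EqOn f.integrand (fun f => 1 / ((1 - f 0) * f 1 * f 2)) f.domain →
      KZ.of q - KZ.of e - KZ.of f ∈ KZ.relations) := by
  sorry

/-- **stub_dihedralCharts** (M). Two rational changes of variables (rule 2) onto the simplex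
`1 > t₀ > t₁ > t₂ > 0`: from `BE`, `(u,v,s) ↦ (u/(u+v), s, u)` (inverse `(t₂, t₂(1−t₀)/t₀, t₁)`,
`|J⁻¹| = t₂/t₀²`), pulling `E_dih = (t₁−t₂)/(t₀(t₀−t₂)(1−t₂)(1−t₁)t₁)` back to the `E`
integrand; from `BF`, `(u,v,s) ↦ (s, u/(u+v), u)` (inverse `(t₂, t₂(1−t₁)/t₁, t₀)`,
`|J⁻¹| = t₂/t₁²`), pulling `F_dih = 1/(t₀t₁(1−t₁)(1−t₂))` back to the `F` integrand.
Tools: `ratChart_transport`. -/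
theorem stub_dihedralCharts :
    (∀ d : KZ.IntegralRep 3, d.domain = {t : Fin 3 → ℝ | 1 > t 0 ∧ t 0 > t 1 ∧ t 1 > t 2 ∧ t 2 > 0} →
      Set.EqOn d.integrand (fun t => (t 1 - t 2) / (t 0 * (t 0 - t 2) * (1 - t 2) * (1 - t 1) * t 1)) d.domain →
      ∃ e : KZ.IntegralRep 3, e.domain = {e : Fin 3 → ℝ | 0 < e 0 ∧ 0 < e 1 ∧ e 0 + e 1 < 1 ∧ e 0 < e 2 ∧ e 2 * (e 0 + e 1) < e 0} ∧
        e.integrand = fun e => (e 2 - e 0) / (e 0 * (1 - e 0) * (1 - e 2) * (1 - e 0 - e 1) * e 2)) ∧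
    (∀ e d : KZ.IntegralRep 3, e.domain = {e : Fin 3 → ℝ | 0 < e 0 ∧ 0 < e 1 ∧ e 0 + e 1 < 1 ∧ e 0 < e 2 ∧ e 2 * (e 0 + e 1) < e 0} →
      Set.EqOn e.integrand (fun e => (e 2 - e 0) / (e 0 * (1 - e 0) * (1 - e 2) * (1 - e 0 - e 1) * e 2)) e.domain →
      d.domain = {t : Fin 3 → ℝ | 1 > t 0 ∧ t 0 > t 1 ∧ t 1 > t 2 ∧ t 2 > 0} →
      Set.EqOn d.integrand (fun t => (t 1 - t 2) / (t 0 * (t 0 - t 2) * (1 - t 2) * (1 - t 1) * t 1)) d.domain →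
      KZ.Equivalent e d) ∧
    (∀ d : KZ.IntegralRep 3, d.domain = {t : Fin 3 → ℝ | 1 > t 0 ∧ t 0 > t 1 ∧ t 1 > t 2 ∧ t 2 > 0} →
      Set.EqOn d.integrand (fun t => 1 / (t 0 * t 1 * (1 - t 1) * (1 - t 2))) d.domain →
      ∃ f : KZ.IntegralRep 3, f.domain = {f : Fin 3 → ℝ | 0 < f 0 ∧ 0 < f 1 ∧ f 0 + f 1 < 1 ∧ f 0 < f 2 * (f 0 + f 1) ∧ f 2 < 1} ∧
        f.integrand = fun f => 1 / ((1 - f 0) * f 1 * f 2)) ∧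
    (∀ f d : KZ.IntegralRep 3, f.domain = {f : Fin 3 → ℝ | 0 < f 0 ∧ 0 < f 1 ∧ f 0 + f 1 < 1 ∧ f 0 < f 2 * (f 0 + f 1) ∧ f 2 < 1} →
      Set.EqOn f.integrand (fun f => 1 / ((1 - f 0) * f 1 * f 2)) f.domain →
      d.domain = {t : Fin 3 → ℝ | 1 > t 0 ∧ t 0 > t 1 ∧ t 1 > t 2 ∧ t 2 > 0} →
      Set.EqOn d.integrand (fun t => 1 / (t 0 * t 1 * (1 - t 1) * (1 - t 2))) d.domain →
      KZ.Equivalent f d) := by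
  sorry

/-- **stub_eSplit** (S; lead). Integrand additivity (rule 1b) on the simplex:
`E_dih = E₁ − E₂`, `E₁ = 1/(t₀(t₀−t₂)(1−t₁))`, `E₂ = t₂/(t₀(t₀−t₂)(1−t₂)t₁)` (the `E_dih`
representation exists as a difference of the two given ones). -/
theorem stub_eSplit :
    ∀ e₁ e₂ : KZ.IntegralRep 3, e₁.domain = {t : Fin 3 → ℝ | 1 > t 0 ∧ t 0 > t 1 ∧ t 1 > t 2 ∧ t 2 > 0} →
      Set.EqOn e₁.integrand (fun t => 1 / (t 0 * (t 0 - t 2) * (1 - t 1))) e₁.domain →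
      e₂.domain = {t : Fin 3 → ℝ | 1 > t 0 ∧ t 0 > t 1 ∧ t 1 > t 2 ∧ t 2 > 0} →
      Set.EqOn e₂.integrand (fun t => t 2 / (t 0 * (t 0 - t 2) * (1 - t 2) * t 1)) e₂.domain →
      ∃ d : KZ.IntegralRep 3, d.domain = {t : Fin 3 → ℝ | 1 > t 0 ∧ t 0 > t 1 ∧ t 1 > t 2 ∧ t 2 > 0} ∧
        (d.integrand = fun t => (t 1 - t 2) / (t 0 * (t 0 - t 2) * (1 - t 2) * (1 - t 1) * t 1)) ∧
        KZ.of d - KZ.of e₁ + KZ.of e₂ ∈ KZ.relations := by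
  sorry

/-- **stub_fSplit** (S; lead). Integrand additivity (rule 1b) on the simplex:
`F_dih = 1/(t₀t₁(1−t₂)) + 1/(t₀(1−t₁)(1−t₂))` (`ζ(3)` word + `ζ(2,1)` word). -/
theorem stub_fSplit :
    ∀ z z' : KZ.IntegralRep 3, z.domain = {t : Fin 3 → ℝ | 1 > t 0 ∧ t 0 > t 1 ∧ t 1 > t 2 ∧ t 2 > 0} →
      Set.EqOn z.integrand (fun t => 1 / (t 0 * t 1 * (1 - t 2))) z.domain →
      z'.domain = {t : Fin 3 → ℝ | 1 > t 0 ∧ t 0 > t 1 ∧ t 1 > t 2 ∧ t 2 > 0} →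
      Set.EqOn z'.integrand (fun t => 1 / (t 0 * (1 - t 1) * (1 - t 2))) z'.domain →
      ∃ d : KZ.IntegralRep 3, d.domain = {t : Fin 3 → ℝ | 1 > t 0 ∧ t 0 > t 1 ∧ t 1 > t 2 ∧ t 2 > 0} ∧
        (d.integrand = fun t => 1 / (t 0 * t 1 * (1 - t 1) * (1 - t 2))) ∧
        KZ.of d - KZ.of z - KZ.of z' ∈ KZ.relations := by
  sorry

/-- **stub_wordCharts** (M–L). The two level-one endgames on the simplex `1 > t₀ > t₁ > t₂ > 0`:
(E₁) the rational chart `(t₀,t₁,t₂) ↦ (t₁/t₀, t₁, t₂/t₀)` (rule 2) maps the simplex onto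
`W = {0 < w₁ < w₀ < 1, 0 < w₂ < w₀}` and pulls `1/(w₀(1−w₁)(1−w₂))` back to `E₁` (`|J| = t₁²… `
see brief); `W` splits along the null wall `w₁ = w₂` (rule 1a) into the `ζ(2,1)` word on the
simplex and its image under the coordinate swap `w₁ ↔ w₂` (rule 2, a `permRel`/`reindex` move), so
`[E₁] ≡ 2·[ζ(2,1)-word]`; (E₂) the rational chart `(t₀,t₁,t₂) ↦ (t₁/t₀, t₂/t₀, t₂)` maps the
simplex onto itself and pulls the `ζ(2,1)` word back to `E₂`, so `[E₂] ≡ [ζ(2,1)-word]`.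
Tools: `ratChart_transport`, `KZ.of_sub_of_reindex_mem_relations`,
`KZ.IntegralRep.of_sub_of_restrict_mem_relations`. -/
theorem stub_wordCharts :
    (∀ z' : KZ.IntegralRep 3, z'.domain = {t : Fin 3 → ℝ | 1 > t 0 ∧ t 0 > t 1 ∧ t 1 > t 2 ∧ t 2 > 0} →
      Set.EqOn z'.integrand (fun t => 1 / (t 0 * (1 - t 1) * (1 - t 2))) z'.domain →
      ∃ e₁ : KZ.IntegralRep 3, e₁.domain = {t : Fin 3 → ℝ | 1 > t 0 ∧ t 0 > t 1 ∧ t 1 > t 2 ∧ t 2 > 0} ∧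
        e₁.integrand = fun t => 1 / (t 0 * (t 0 - t 2) * (1 - t 1))) ∧
    (∀ e₁ z' : KZ.IntegralRep 3, e₁.domain = {t : Fin 3 → ℝ | 1 > t 0 ∧ t 0 > t 1 ∧ t 1 > t 2 ∧ t 2 > 0} →
      Set.EqOn e₁.integrand (fun t => 1 / (t 0 * (t 0 - t 2) * (1 - t 1))) e₁.domain →
      z'.domain = {t : Fin 3 → ℝ | 1 > t 0 ∧ t 0 > t 1 ∧ t 1 > t 2 ∧ t 2 > 0} →
      Set.EqOn z'.integrand (fun t => 1 / (t 0 * (1 - t 1) * (1 - t 2))) z'.domain →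
      KZ.of e₁ - 2 • KZ.of z' ∈ KZ.relations) ∧
    (∀ z' : KZ.IntegralRep 3, z'.domain = {t : Fin 3 → ℝ | 1 > t 0 ∧ t 0 > t 1 ∧ t 1 > t 2 ∧ t 2 > 0} →
      Set.EqOn z'.integrand (fun t => 1 / (t 0 * (1 - t 1) * (1 - t 2))) z'.domain →
      ∃ e₂ : KZ.IntegralRep 3, e₂.domain = {t : Fin 3 → ℝ | 1 > t 0 ∧ t 0 > t 1 ∧ t 1 > t 2 ∧ t 2 > 0} ∧
        e₂.integrand = fun t => t 2 / (t 0 * (t 0 - t 2) * (1 - t 2) * t 1)) ∧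
    (∀ e₂ z' : KZ.IntegralRep 3, e₂.domain = {t : Fin 3 → ℝ | 1 > t 0 ∧ t 0 > t 1 ∧ t 1 > t 2 ∧ t 2 > 0} →
      Set.EqOn e₂.integrand (fun t => t 2 / (t 0 * (t 0 - t 2) * (1 - t 2) * t 1)) e₂.domain →
      z'.domain = {t : Fin 3 → ℝ | 1 > t 0 ∧ t 0 > t 1 ∧ t 1 > t 2 ∧ t 2 > 0} →
      Set.EqOn z'.integrand (fun t => 1 / (t 0 * (1 - t 1) * (1 - t 2))) z'.domain →
      KZ.of e₂ - KZ.of z' ∈ KZ.relations) := by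
  sorry

/-! ## The crux from the stubs -/

/-- **The crux from the stubs.** `LinRedNormalForm.WheelThreeSpokes` BY NAME: for every wheel
representation `r` and every `6ζ(3)` simplex representation `r'` as quantified in the crux,
`KZ.Equivalent r r'`. Bookkeeping in the free abelian group: `[r] ≡ [s₅] ≡ [d₅] ≡ [b₅] ≡ [r₄] ≡
2[p] ≡ 2[q] ≡ 2([e] + [f]) ≡ 2([E_dih] + [F_dih]) ≡ 2(([E₁] − [E₂]) + ([Z] + [Z'])) ≡
2((2[Z'] − [Z']) + [Z] + [Z']) = 2[Z] + 4[Z'] ≡ 6[Z] ≡ [r']` (duality `[Z'] ≡ [Z]` four times). -/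
theorem WheelThreeSpokes_of : WheelThreeSpokes := by
  intro r r' h1 h2 h3 h4
  -- the two word representations and duality
  obtain ⟨Z, hZd, hZi⟩ := exists_zeta3Word_rep
  obtain ⟨Z', hZ'd, hZ'i⟩ := exists_zeta21Word_rep
  have hZi' : EqOn Z.integrand (fun t => 1 / (t 0 * t 1 * (1 - t 2))) Z.domain := by
    rw [hZi]; exact fun _ _ => rfl
  have hZ'i' : EqOn Z'.integrand (fun t => 1 / (t 0 * (1 - t 1) * (1 - t 2))) Z'.domain := by
    rw [hZ'i]; exact fun _ _ => rfl
  have hdual : KZ.of Z' - KZ.of Z ∈ KZ.relations :=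
    zeta21Word_sub_zeta3Word_mem_relations Z Z' hZd hZi' hZ'd hZ'i'
  -- the endgame, backwards: E₁, E₂, E_dih, F_dih, E, F
  obtain ⟨hW1, hW2, hW3, hW4⟩ := stub_wordCharts
  obtain ⟨e₁, he₁d, he₁i⟩ := hW1 Z' hZ'd hZ'i'
  have he₁i' : EqOn e₁.integrand (fun t => 1 / (t 0 * (t 0 - t 2) * (1 - t 1))) e₁.domain := by
    rw [he₁i]; exact fun _ _ => rfl
  have he₁rel := hW2 e₁ Z' he₁d he₁i' hZ'd hZ'i'
  obtain ⟨e₂, he₂d, he₂i⟩ := hW3 Z' hZ'd hZ'i'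
  have he₂i' : EqOn e₂.integrand (fun t => t 2 / (t 0 * (t 0 - t 2) * (1 - t 2) * t 1)) e₂.domain := by
    rw [he₂i]; exact fun _ _ => rfl
  have he₂rel := hW4 e₂ Z' he₂d he₂i' hZ'd hZ'i'
  obtain ⟨ed, hedd, hedi, hedrel⟩ := stub_eSplit e₁ e₂ he₁d he₁i' he₂d he₂i'
  have hedi' : EqOn ed.integrand
      (fun t => (t 1 - t 2) / (t 0 * (t 0 - t 2) * (1 - t 2) * (1 - t 1) * t 1)) ed.domain := by
    rw [hedi]; exact fun _ _ => rfl
  obtain ⟨fd, hfdd, hfdi, hfdrel⟩ := stub_fSplit Z Z' hZd hZi' hZ'd hZ'i'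
  have hfdi' : EqOn fd.integrand (fun t => 1 / (t 0 * t 1 * (1 - t 1) * (1 - t 2))) fd.domain := by
    rw [hfdi]; exact fun _ _ => rfl
  obtain ⟨hD1, hD2, hD3, hD4⟩ := stub_dihedralCharts
  obtain ⟨e, hed, hei⟩ := hD1 ed hedd hedi'
  have hei' : EqOn e.integrand
      (fun e => (e 2 - e 0) / (e 0 * (1 - e 0) * (1 - e 2) * (1 - e 0 - e 1) * e 2)) e.domain := by
    rw [hei]; exact fun _ _ => rfl
  have herel : KZ.of e - KZ.of ed ∈ KZ.relations := hD2 e ed hed hei' hedd hedi'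
  obtain ⟨f, hfd, hfi⟩ := hD3 fd hfdd hfdi'
  have hfi' : EqOn f.integrand (fun f => 1 / ((1 - f 0) * f 1 * f 2)) f.domain := by
    rw [hfi]; exact fun _ _ => rfl
  have hfrel : KZ.of f - KZ.of fd ∈ KZ.relations := hD4 f fd hfd hfi' hfdd hfdi'
  -- the descent 4 → 3 and Möbius storage, backwards: Q, P2, D4
  obtain ⟨hU1, hU2⟩ := stub_unipotentDescent
  obtain ⟨q, hqd, hqi⟩ := hU1 e f hed hei' hfd hfi'
  have hqi' : EqOn q.integrand (fun q => 1 / (q 1 * (1 - q 0 - q 1) * q 2)) q.domain := by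
    rw [hqi]; exact fun _ _ => rfl
  have hqrel := hU2 q e f hqd hqi' hed hei' hfd hfi'
  obtain ⟨hM1, hM2⟩ := stub_moebius
  obtain ⟨p, hpd, hpi⟩ := hM1 q hqd hqi'
  have hpi' : EqOn p.integrand
      (fun p => 1 / (p 3 * (p 1 * (1 - p 0 - p 1) + p 2 * (1 - p 2) * p 3))) p.domain := by
    rw [hpi]; exact fun _ _ => rfl
  have hprel := hM2 p q hpd hpi' hqd hqi'
  obtain ⟨hC1, hC2⟩ := stub_doubling
  obtain ⟨r₄, hr₄d, hr₄i⟩ := hC1 p hpd hpi'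
  have hr₄i' : EqOn r₄.integrand
      (fun p => 1 / (p 3 * (p 1 * (1 - p 0 - p 1) + p 2 * (1 - p 2) * p 3))) r₄.domain := by
    rw [hr₄i]; exact fun _ _ => rfl
  have hr₄rel := hC2 r₄ p hr₄d hr₄i' hpd hpi'
  -- the charts, forwards from the wheel: Z5, D5, D5T
  obtain ⟨hA1, hA2⟩ := stub_dehomogenise
  obtain ⟨s₅, hs₅d, hs₅i⟩ := hA1 r h1 h2
  have hs₅i' : EqOn s₅.integrand (fun z => 1 / ((z 0 + z 2 + z 3) * (z 1 + z 2 + z 4) - z 2 ^ 2 -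
      z 0 ^ 2 * (z 1 + z 2 + z 4) - 2 * z 0 * z 1 * z 2 - z 1 ^ 2 * (z 0 + z 2 + z 3)) ^ 2)
      s₅.domain := by
    rw [hs₅i]; exact fun _ _ => rfl
  have hs₅rel : KZ.of s₅ - KZ.of r ∈ KZ.relations := hA2 s₅ r hs₅d hs₅i' h1 h2
  obtain ⟨hL1, hL2⟩ := stub_ldlChart
  obtain ⟨d₅, hd₅d, hd₅i⟩ := hL1 s₅ hs₅d hs₅i'
  have hd₅i' : EqOn d₅.integrand (fun y => 1 / (y 3 * y 4 ^ 2)) d₅.domain := by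
    rw [hd₅i]; exact fun _ _ => rfl
  have hd₅rel : KZ.of d₅ - KZ.of s₅ ∈ KZ.relations := hL2 d₅ s₅ hd₅d hd₅i' hs₅d hs₅i'
  obtain ⟨hT1, hT2⟩ := stub_tailChart
  obtain ⟨b₅, hb₅d, hb₅i⟩ := hT1 d₅ hd₅d hd₅i'
  have hb₅i' : EqOn b₅.integrand
      (fun y => 1 / (y 3 * (y 1 * (1 - y 0 - y 1) + y 2 * (1 - y 2) * y 3))) b₅.domain := by
    rw [hb₅i]; exact fun _ _ => rfl
  have hb₅rel : KZ.of b₅ - KZ.of d₅ ∈ KZ.relations := hT2 b₅ d₅ hb₅d hb₅i' hd₅d hd₅i'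
  -- Newton–Leibniz 5 → 4
  have hnl : KZ.of b₅ - KZ.of r₄ ∈ KZ.relations := stub_nlFiveFour b₅ r₄ hb₅d hb₅i' hr₄d hr₄i'
  -- the target side: [r'] ≡ 6 [Z]
  have hr' : KZ.of r' - 6 • KZ.of Z ∈ KZ.relations := by
    refine of_sub_nsmul_of_mem_relations 6 r' Z (by rw [hZd, h3]) fun t ht => ?_
    rw [h4 ht, hZi]
    push_cast
    ring
  -- bookkeeping
  unfold KZ.Equivalent
  have key : KZ.of r - KZ.of r' =
      -(KZ.of s₅ - KZ.of r) - (KZ.of d₅ - KZ.of s₅) - (KZ.of b₅ - KZ.of d₅) + (KZ.of b₅ - KZ.of r₄) +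
      (KZ.of r₄ - 2 • KZ.of p) + 2 • (KZ.of p - KZ.of q) + 2 • (KZ.of q - KZ.of e - KZ.of f) +
      2 • (KZ.of e - KZ.of ed) + 2 • (KZ.of f - KZ.of fd) +
      2 • (KZ.of ed - KZ.of e₁ + KZ.of e₂) + 2 • (KZ.of fd - KZ.of Z - KZ.of Z') +
      2 • (KZ.of e₁ - 2 • KZ.of Z') - 2 • (KZ.of e₂ - KZ.of Z') + 4 • (KZ.of Z' - KZ.of Z) -
      (KZ.of r' - 6 • KZ.of Z) := by
    abel
  rw [key]
  exact sub_mem (add_mem (sub_mem (add_mem (add_mem (add_mem (add_mem (add_mem (add_mem (add_mem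
    (add_mem (add_mem (sub_mem (sub_mem (neg_mem hs₅rel) hd₅rel) hb₅rel) hnl) hr₄rel) (nsmul_mem
    hprel 2)) (nsmul_mem hqrel 2)) (nsmul_mem herel 2)) (nsmul_mem hfrel 2)) (nsmul_mem hedrel 2))
    (nsmul_mem hfdrel 2)) (nsmul_mem he₁rel 2)) (nsmul_mem he₂rel 2)) (nsmul_mem hdual 4)) hr'

end Summit.KontsevichZagierPeriods.LinRedNormalForm.WheelThreeSpokes.Skeleton
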